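import Summits.AtomisticToContinuum.FouriersLaw.Theorems.BondHeatUncertaintySubdiffusiveBondHeatKernelDetailedBalanceLaplaceA

/-!
# `HonestZwanzig.FeshbachIdentities`, part 1: equilibrium correlation functions of nice observables

Support file for item `stmt-AtomisticToContinuum-12697` (`HonestZwanzig.FeshbachIdentities`, the fixed-`N`
package behind the Feshbach block algebra of route `HonestZwanzig`). For the pinned anharmonic chain
`P = pinnedChain ω₂ lam β γ` (`ω₂ > 0`, `lam ≥ 0`, `β, γ > 0`), `N ≥ 1` sites, equal bath temperatures `T > 0`,
the canonical equilibrium objects `μ_T = gibbsMeasure N T`, `P_t = transitionKernel N T T t` and NICE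
observables `f, g` (continuous, `|f| ≤ C_f e^{ϑH}`, `|g| ≤ C_g e^{ϑH}` with `0 < ϑ`, `2ϑ < 1/T`):

* `pinnedChain_integrable_mul_act_nice` — `z ↦ f(z) P_u g(z)` is `μ_T`-integrable (weighted AM–GM and the
  `L²(μ_T)`-contraction `pinnedChain_integral_sq_act_le`);
* `pinnedChain_corr_eq_integral_sub` — `⟨f, P_u g⟩ - μ_T(f)μ_T(g) = ∫ f (P_u g - μ_T g) dμ_T`;
* `pinnedChain_abs_corr_le_exp_nice` — **exponential mixing of the truncated correlation**
  `|⟨f, P_u g⟩_{μ_T} - μ_T(f) μ_T(g)| ≤ C e^{-cu}` (CEHR Thm 2.13 (3) at equilibrium, `pinnedChain_harris_bound`);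
* `pinnedChain_integrableOn_corr_nice` — hence `t ↦ corr(f,g)(t) ∈ L¹((0,∞))`, the Laplace integrand
  `e^{-st} corr(f,g)(t)` is integrable for `s ≥ 0`, and `|lap_s(f,g)| < ∞` bookkeeping.

This is clause (i) of the item for the class `Adm = {continuous, O(e^{H/(8T)})}` (`ϑ = 1/(8T)`).
-/

noncomputable section

open MeasureTheory ProbabilityTheory Filter Topology Set Function
open scoped NNReal ENNReal
open Literature.MathematicalPhysics.KineticTheory.HeatConduction
open Literature.MathematicalPhysics.KineticTheory OscillatorChain
open Summit.AtomisticToContinuum.FouriersLaw.Theorems.SubdiffusiveBondHeat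
open Summit.AtomisticToContinuum.FouriersLaw.Theorems.OddSectorIrreversibility

namespace Summit.AtomisticToContinuum.FouriersLaw.Theorems.HonestZwanzig

variable {N : ℕ}

section Pinned

variable {ω₂ lam β γ : ℝ} (hω : 0 < ω₂) (hl : 0 ≤ lam) (hβ : 0 < β) (hγ : 0 < γ) (hN : 0 < N)
  {T : ℝ} (hT : 0 < T)
include hω hl hβ hγ hN hT

/-! ### Static integrability of nice observables -/

omit hγ hN in
/-- A nice observable is `μ_T`-integrable (`e^{ϑH} ∈ L¹(μ_T)` for `ϑ < 1/T`). [folklore] -/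
theorem pinnedChain_integrable_nice {ϑ : ℝ} (hϑ1 : ϑ < 1 / T) {f : PhaseSpace N → ℝ} (hf : Continuous f)
    {Cf : ℝ} (hfb : ∀ y, |f y| ≤ Cf * Real.exp (ϑ * (pinnedChain ω₂ lam β γ).hamiltonian N y)) :
    Integrable f ((pinnedChain ω₂ lam β γ).gibbsMeasure N T) :=
  integrable_of_abs_le_exp (pinnedChain_integrable_exp_mul_hamiltonian_gibbsMeasure hω hl hβ.le γ N hT hϑ1) hf hfb

omit hω hl hβ hγ hN hT in
/-- The square of a nice observable is nice with the doubled exponent. [folklore] -/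
theorem abs_sq_le_exp_bound {ϑ : ℝ} {f : PhaseSpace N → ℝ} {Cf : ℝ}
    (hfb : ∀ y, |f y| ≤ Cf * Real.exp (ϑ * (pinnedChain ω₂ lam β γ).hamiltonian N y)) (y : PhaseSpace N) :
    |f y ^ 2| ≤ Cf ^ 2 * Real.exp (2 * ϑ * (pinnedChain ω₂ lam β γ).hamiltonian N y) := by
  rw [abs_pow, show Cf ^ 2 * Real.exp (2 * ϑ * (pinnedChain ω₂ lam β γ).hamiltonian N y) =
    (Cf * Real.exp (ϑ * (pinnedChain ω₂ lam β γ).hamiltonian N y)) ^ 2 by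
      rw [mul_pow, ← Real.exp_nat_mul]; ring_nf]
  exact pow_le_pow_left₀ (abs_nonneg _) (hfb y) 2

omit hω hl hβ hγ hN hT in
/-- The product of two nice observables is nice with the summed... doubled exponent. [folklore] -/
theorem abs_mul_le_exp_bound {ϑ : ℝ} {f g : PhaseSpace N → ℝ} {Cf Cg : ℝ} (hCf : 0 ≤ Cf)
    (hfb : ∀ y, |f y| ≤ Cf * Real.exp (ϑ * (pinnedChain ω₂ lam β γ).hamiltonian N y))
    (hgb : ∀ y, |g y| ≤ Cg * Real.exp (ϑ * (pinnedChain ω₂ lam β γ).hamiltonian N y)) (y : PhaseSpace N) :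
    |f y * g y| ≤ Cf * Cg * Real.exp (2 * ϑ * (pinnedChain ω₂ lam β γ).hamiltonian N y) := by
  rw [abs_mul, show Cf * Cg * Real.exp (2 * ϑ * (pinnedChain ω₂ lam β γ).hamiltonian N y) =
    (Cf * Real.exp (ϑ * (pinnedChain ω₂ lam β γ).hamiltonian N y)) *
      (Cg * Real.exp (ϑ * (pinnedChain ω₂ lam β γ).hamiltonian N y)) by
      rw [show 2 * ϑ * (pinnedChain ω₂ lam β γ).hamiltonian N y =
        ϑ * (pinnedChain ω₂ lam β γ).hamiltonian N y + ϑ * (pinnedChain ω₂ lam β γ).hamiltonian N y by ring,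
        Real.exp_add]; ring]
  exact mul_le_mul (hfb y) (hgb y) (abs_nonneg _) (by positivity)

omit hγ hN in
/-- The square of a nice observable (`2ϑ < 1/T`) is `μ_T`-integrable. [folklore] -/
theorem pinnedChain_integrable_sq_nice {ϑ : ℝ} (h2ϑ : 2 * ϑ < 1 / T) {f : PhaseSpace N → ℝ}
    (hf : Continuous f) {Cf : ℝ} (hfb : ∀ y, |f y| ≤ Cf * Real.exp (ϑ * (pinnedChain ω₂ lam β γ).hamiltonian N y)) :
    Integrable (fun y => f y ^ 2) ((pinnedChain ω₂ lam β γ).gibbsMeasure N T) :=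
  integrable_of_abs_le_exp (pinnedChain_integrable_exp_mul_hamiltonian_gibbsMeasure hω hl hβ.le γ N hT h2ϑ)
    (hf.pow 2) (abs_sq_le_exp_bound hfb)

omit hγ hN in
/-- The product of two nice observables (`2ϑ < 1/T`) is `μ_T`-integrable. [folklore] -/
theorem pinnedChain_integrable_mul_nice {ϑ : ℝ} (h2ϑ : 2 * ϑ < 1 / T) {f g : PhaseSpace N → ℝ}
    (hf : Continuous f) (hg : Continuous g) {Cf Cg : ℝ} (hCf : 0 ≤ Cf)
    (hfb : ∀ y, |f y| ≤ Cf * Real.exp (ϑ * (pinnedChain ω₂ lam β γ).hamiltonian N y))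
    (hgb : ∀ y, |g y| ≤ Cg * Real.exp (ϑ * (pinnedChain ω₂ lam β γ).hamiltonian N y)) :
    Integrable (fun y => f y * g y) ((pinnedChain ω₂ lam β γ).gibbsMeasure N T) :=
  integrable_of_abs_le_exp (pinnedChain_integrable_exp_mul_hamiltonian_gibbsMeasure hω hl hβ.le γ N hT h2ϑ)
    (hf.mul hg) (abs_mul_le_exp_bound hCf hfb hgb)

/-! ### The correlation integrand `z ↦ f(z) P_u g(z)` -/

omit hω hl hβ hγ hN hT in
/-- AM–GM domination: `a b ∈ L¹` when `a², b² ∈ L¹` and both are (ae strongly) measurable. [folklore] -/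
theorem integrable_mul_of_sq {μ : Measure (PhaseSpace N)} {a b : PhaseSpace N → ℝ}
    (ham : AEStronglyMeasurable a μ) (hbm : AEStronglyMeasurable b μ)
    (ha : Integrable (fun z => a z ^ 2) μ) (hb : Integrable (fun z => b z ^ 2) μ) :
    Integrable (fun z => a z * b z) μ := by
  have hI : Integrable (fun z => (a z ^ 2 + b z ^ 2) / 2) μ := (ha.add hb).div_const 2
  refine hI.mono' (ham.mul hbm) (Eventually.of_forall fun z => ?_)
  rw [Real.norm_eq_abs, abs_mul]
  nlinarith [sq_nonneg (|a z| - |b z|), sq_abs (a z), sq_abs (b z)]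

/-- **The correlation integrand is integrable**: for nice `f, g` (`0 < ϑ`, `2ϑ < 1/T`) and `u ≥ 0`,
`z ↦ f(z) · P_u g(z)` is `μ_T`-integrable. [folklore] -/
theorem pinnedChain_integrable_mul_act_nice {ϑ : ℝ} (hϑ0 : 0 < ϑ) (h2ϑ : 2 * ϑ < 1 / T)
    {f g : PhaseSpace N → ℝ} (hf : Continuous f) (hg : Continuous g) {Cf Cg : ℝ}
    (hfb : ∀ y, |f y| ≤ Cf * Real.exp (ϑ * (pinnedChain ω₂ lam β γ).hamiltonian N y))
    (hgb : ∀ y, |g y| ≤ Cg * Real.exp (ϑ * (pinnedChain ω₂ lam β γ).hamiltonian N y)) (u : ℝ≥0) :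
    Integrable (fun z => f z * ∫ y, g y ∂((pinnedChain ω₂ lam β γ).transitionKernel N T T u z))
      ((pinnedChain ω₂ lam β γ).gibbsMeasure N T) := by
  obtain ⟨-, hP2, -⟩ := pinnedChain_integral_sq_act_le hω hl hβ hγ hN hT hϑ0 h2ϑ hg hgb u
  exact integrable_mul_of_sq hf.aestronglyMeasurable
    (hg.stronglyMeasurable.integral_kernel (κ := (pinnedChain ω₂ lam β γ).transitionKernel N T T u)).aestronglyMeasurable
    (pinnedChain_integrable_sq_nice hω hl hβ hT h2ϑ hf hfb) hP2

/-- **The truncated correlation as one integral**: for nice `f, g` and `u ≥ 0`,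
`⟨f, P_u g⟩_{μ_T} - μ_T(f) μ_T(g) = ∫ f (P_u g - μ_T(g)) dμ_T`. [folklore] -/
theorem pinnedChain_corr_eq_integral_sub {ϑ : ℝ} (hϑ0 : 0 < ϑ) (h2ϑ : 2 * ϑ < 1 / T)
    {f g : PhaseSpace N → ℝ} (hf : Continuous f) (hg : Continuous g) {Cf Cg : ℝ}
    (hfb : ∀ y, |f y| ≤ Cf * Real.exp (ϑ * (pinnedChain ω₂ lam β γ).hamiltonian N y))
    (hgb : ∀ y, |g y| ≤ Cg * Real.exp (ϑ * (pinnedChain ω₂ lam β γ).hamiltonian N y)) (u : ℝ≥0) :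
    (∫ z, f z * (∫ y, g y ∂((pinnedChain ω₂ lam β γ).transitionKernel N T T u z))
        ∂((pinnedChain ω₂ lam β γ).gibbsMeasure N T)) -
      (∫ z, f z ∂((pinnedChain ω₂ lam β γ).gibbsMeasure N T)) *
        (∫ z, g z ∂((pinnedChain ω₂ lam β γ).gibbsMeasure N T)) =
    ∫ z, f z * ((∫ y, g y ∂((pinnedChain ω₂ lam β γ).transitionKernel N T T u z)) -
        ∫ y, g y ∂((pinnedChain ω₂ lam β γ).gibbsMeasure N T)) ∂((pinnedChain ω₂ lam β γ).gibbsMeasure N T) := by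
  have hϑ1 : ϑ < 1 / T := by linarith
  have hI := pinnedChain_integrable_mul_act_nice hω hl hβ hγ hN hT hϑ0 h2ϑ hf hg hfb hgb u
  have hfI := pinnedChain_integrable_nice hω hl hβ hT hϑ1 hf hfb
  simp only [mul_sub]
  rw [integral_sub hI (hfI.mul_const _), integral_mul_const]

/-! ### Exponential mixing of the truncated correlation -/

/-- **Exponential mixing** (CEHR Thm 2.13 (3) at equilibrium): for `0 < ϑ`, `2ϑ < 1/T` there are `K, c > 0`
such that for all nice `f, g` (constants `C_f, C_g ≥ 0`) and `u ≥ 0`,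
`|⟨f, P_u g⟩_{μ_T} - μ_T(f)μ_T(g)| ≤ K C_f C_g e^{-cu}`: the Harris bound
`|P_u g(z) - μ_T(g)| ≤ K' C_g e^{ϑH(z)} e^{-cu}` integrated against `|f| ≤ C_f e^{ϑH}`, `e^{2ϑH} ∈ L¹(μ_T)`.
[cite: CuneoEckmannHairerReyBellet2018, Thm 2.13 (3)] -/
theorem pinnedChain_abs_corr_le_exp_nice {ϑ : ℝ} (hϑ0 : 0 < ϑ) (h2ϑ : 2 * ϑ < 1 / T) :
    ∃ K c : ℝ, 0 < K ∧ 0 < c ∧ ∀ (f g : PhaseSpace N → ℝ), Continuous f → Continuous g →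
      ∀ (Cf Cg : ℝ), 0 ≤ Cf → 0 ≤ Cg →
      (∀ y, |f y| ≤ Cf * Real.exp (ϑ * (pinnedChain ω₂ lam β γ).hamiltonian N y)) →
      (∀ y, |g y| ≤ Cg * Real.exp (ϑ * (pinnedChain ω₂ lam β γ).hamiltonian N y)) →
      ∀ u : ℝ≥0,
      |(∫ z, f z * (∫ y, g y ∂((pinnedChain ω₂ lam β γ).transitionKernel N T T u z))
          ∂((pinnedChain ω₂ lam β γ).gibbsMeasure N T)) -
        (∫ z, f z ∂((pinnedChain ω₂ lam β γ).gibbsMeasure N T)) *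
          (∫ z, g z ∂((pinnedChain ω₂ lam β γ).gibbsMeasure N T))| ≤ K * Cf * Cg * Real.exp (-c * u) := by
  have hϑ1 : ϑ < 1 / T := by linarith
  obtain ⟨K, c, hK, hc, hb⟩ := pinnedChain_harris_bound hω hl hβ hγ hN hT hϑ0 hϑ1
  set P := pinnedChain ω₂ lam β γ with hP
  set μ := P.gibbsMeasure N T with hμ
  -- the weight `∫ e^{2ϑH} dμ_T`
  have hE2 : Integrable (fun z => Real.exp (2 * ϑ * P.hamiltonian N z)) μ :=
    pinnedChain_integrable_exp_mul_hamiltonian_gibbsMeasure hω hl hβ.le γ N hT h2ϑ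
  set W : ℝ := ∫ z, Real.exp (2 * ϑ * P.hamiltonian N z) ∂μ with hW
  have hW0 : 0 ≤ W := integral_nonneg fun z => (Real.exp_pos _).le
  refine ⟨K * W + 1, c, by positivity, hc, fun f g hf hg Cf Cg hCf hCg hfb hgb u => ?_⟩
  rw [pinnedChain_corr_eq_integral_sub hω hl hβ hγ hN hT hϑ0 h2ϑ hf hg hfb hgb u]
  -- pointwise bound on the integrand
  have hpt : ∀ z, ‖f z * ((∫ y, g y ∂(P.transitionKernel N T T u z)) - ∫ y, g y ∂μ)‖ ≤
      K * Cf * Cg * Real.exp (-c * u) * Real.exp (2 * ϑ * P.hamiltonian N z) := by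
    intro z
    rw [norm_mul, Real.norm_eq_abs, Real.norm_eq_abs]
    have h1 := hfb z
    have h2 := hb z u g hg Cg hCg hgb
    have e2 : Real.exp (2 * ϑ * P.hamiltonian N z) =
        Real.exp (ϑ * P.hamiltonian N z) * Real.exp (ϑ * P.hamiltonian N z) := by
      rw [← Real.exp_add]; ring_nf
    calc |f z| * |(∫ y, g y ∂(P.transitionKernel N T T u z)) - ∫ y, g y ∂μ|
        ≤ (Cf * Real.exp (ϑ * P.hamiltonian N z)) *
            (K * Cg * Real.exp (ϑ * P.hamiltonian N z) * Real.exp (-c * u)) :=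
          mul_le_mul h1 h2 (abs_nonneg _) (by positivity)
      _ = K * Cf * Cg * Real.exp (-c * u) * Real.exp (2 * ϑ * P.hamiltonian N z) := by rw [e2]; ring
  have hIb : Integrable (fun z => K * Cf * Cg * Real.exp (-c * u) * Real.exp (2 * ϑ * P.hamiltonian N z)) μ :=
    hE2.const_mul _
  have h := norm_integral_le_of_norm_le hIb (Eventually.of_forall hpt)
  rw [Real.norm_eq_abs, integral_const_mul] at h
  calc _ ≤ K * Cf * Cg * Real.exp (-c * u) * W := h
    _ = (K * W) * Cf * Cg * Real.exp (-c * u) := by ring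
    _ ≤ (K * W + 1) * Cf * Cg * Real.exp (-c * u) := by
        have : 0 ≤ Cf * Cg * Real.exp (-c * u) := by positivity
        nlinarith

/-! ### Measurability and integrability in time -/

omit hβ hγ hN hT in
/-- `t ↦ corr(f,g)(t) = ⟨f, P_{t⁺} g⟩ - μ_T(f)μ_T(g)` is (strongly) measurable for measurable `f, g`. [folklore] -/
theorem pinnedChain_stronglyMeasurable_corr_sub (hβ' : 0 ≤ β) (hγ' : 0 ≤ γ) {f g : PhaseSpace N → ℝ}
    (hf : Measurable f) (hg : Measurable g) :
    StronglyMeasurable fun t : ℝ => (∫ z, f z * (∫ y, g y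
      ∂((pinnedChain ω₂ lam β γ).transitionKernel N T T t.toNNReal z)) ∂((pinnedChain ω₂ lam β γ).gibbsMeasure N T)) -
      (∫ z, f z ∂((pinnedChain ω₂ lam β γ).gibbsMeasure N T)) *
        (∫ z, g z ∂((pinnedChain ω₂ lam β γ).gibbsMeasure N T)) :=
  (pinnedChain_stronglyMeasurable_corr hω hl hβ' hγ' (T := T) hf hg).sub stronglyMeasurable_const

/-- **`corr(f,g) ∈ L¹((0,∞))`** for nice `f, g` (`0 < ϑ`, `2ϑ < 1/T`): measurability and exponential mixing.
[cite: CuneoEckmannHairerReyBellet2018, Thm 2.13 (3)] -/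
theorem pinnedChain_integrableOn_corr_nice {ϑ : ℝ} (hϑ0 : 0 < ϑ) (h2ϑ : 2 * ϑ < 1 / T)
    {f g : PhaseSpace N → ℝ} (hf : Continuous f) (hg : Continuous g) {Cf Cg : ℝ} (hCf : 0 ≤ Cf) (hCg : 0 ≤ Cg)
    (hfb : ∀ y, |f y| ≤ Cf * Real.exp (ϑ * (pinnedChain ω₂ lam β γ).hamiltonian N y))
    (hgb : ∀ y, |g y| ≤ Cg * Real.exp (ϑ * (pinnedChain ω₂ lam β γ).hamiltonian N y)) :
    IntegrableOn (fun t : ℝ => (∫ z, f z * (∫ y, g y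
      ∂((pinnedChain ω₂ lam β γ).transitionKernel N T T t.toNNReal z)) ∂((pinnedChain ω₂ lam β γ).gibbsMeasure N T)) -
      (∫ z, f z ∂((pinnedChain ω₂ lam β γ).gibbsMeasure N T)) *
        (∫ z, g z ∂((pinnedChain ω₂ lam β γ).gibbsMeasure N T))) (Ioi 0) := by
  obtain ⟨K, c, hK, hc, hb⟩ := pinnedChain_abs_corr_le_exp_nice hω hl hβ hγ hN hT hϑ0 h2ϑ
  refine Integrable.mono' ((exp_neg_integrableOn_Ioi 0 hc).const_mul (K * Cf * Cg))
    (pinnedChain_stronglyMeasurable_corr_sub hω hl hβ.le hγ.le hf.measurable hg.measurable).aestronglyMeasurable ?_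
  refine (ae_restrict_iff' measurableSet_Ioi).2 (Eventually.of_forall fun t ht => ?_)
  rw [Real.norm_eq_abs]
  have h := hb f g hf hg Cf Cg hCf hCg hfb hgb t.toNNReal
  rwa [Real.coe_toNNReal _ (le_of_lt ht)] at h

/-- **A `t`-uniform bound on the truncated correlation**: `|corr(f,g)(t)| ≤ K C_f C_g` for all real `t`
(the kernels at `t⁺`). [folklore] -/
theorem pinnedChain_abs_corr_le_nice {ϑ : ℝ} (hϑ0 : 0 < ϑ) (h2ϑ : 2 * ϑ < 1 / T) :
    ∃ K : ℝ, 0 < K ∧ ∀ (f g : PhaseSpace N → ℝ), Continuous f → Continuous g →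
      ∀ (Cf Cg : ℝ), 0 ≤ Cf → 0 ≤ Cg →
      (∀ y, |f y| ≤ Cf * Real.exp (ϑ * (pinnedChain ω₂ lam β γ).hamiltonian N y)) →
      (∀ y, |g y| ≤ Cg * Real.exp (ϑ * (pinnedChain ω₂ lam β γ).hamiltonian N y)) →
      ∀ t : ℝ,
      |(∫ z, f z * (∫ y, g y ∂((pinnedChain ω₂ lam β γ).transitionKernel N T T t.toNNReal z))
          ∂((pinnedChain ω₂ lam β γ).gibbsMeasure N T)) -
        (∫ z, f z ∂((pinnedChain ω₂ lam β γ).gibbsMeasure N T)) *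
          (∫ z, g z ∂((pinnedChain ω₂ lam β γ).gibbsMeasure N T))| ≤ K * Cf * Cg := by
  obtain ⟨K, c, hK, hc, hb⟩ := pinnedChain_abs_corr_le_exp_nice hω hl hβ hγ hN hT hϑ0 h2ϑ
  refine ⟨K, hK, fun f g hf hg Cf Cg hCf hCg hfb hgb t => (hb f g hf hg Cf Cg hCf hCg hfb hgb t.toNNReal).trans ?_⟩
  have h1 : Real.exp (-c * (t.toNNReal : ℝ)) ≤ 1 :=
    Real.exp_le_one_iff.2 (by nlinarith [(t.toNNReal).coe_nonneg, hc])
  have h0 : 0 ≤ K * Cf * Cg := by positivity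
  calc K * Cf * Cg * Real.exp (-c * (t.toNNReal : ℝ)) ≤ K * Cf * Cg * 1 := mul_le_mul_of_nonneg_left h1 h0
    _ = K * Cf * Cg := mul_one _

/-- **The Laplace integrand is integrable**: for nice `f, g` and every `s ≥ 0`,
`t ↦ e^{-st} corr(f,g)(t)` is integrable on `(0,∞)`. [folklore] -/
theorem pinnedChain_integrableOn_exp_mul_corr_nice {ϑ : ℝ} (hϑ0 : 0 < ϑ) (h2ϑ : 2 * ϑ < 1 / T)
    {f g : PhaseSpace N → ℝ} (hf : Continuous f) (hg : Continuous g) {Cf Cg : ℝ} (hCf : 0 ≤ Cf) (hCg : 0 ≤ Cg)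
    (hfb : ∀ y, |f y| ≤ Cf * Real.exp (ϑ * (pinnedChain ω₂ lam β γ).hamiltonian N y))
    (hgb : ∀ y, |g y| ≤ Cg * Real.exp (ϑ * (pinnedChain ω₂ lam β γ).hamiltonian N y)) {s : ℝ} (hs : 0 ≤ s) :
    IntegrableOn (fun t : ℝ => Real.exp (-(s * t)) * ((∫ z, f z * (∫ y, g y
      ∂((pinnedChain ω₂ lam β γ).transitionKernel N T T t.toNNReal z)) ∂((pinnedChain ω₂ lam β γ).gibbsMeasure N T)) -
      (∫ z, f z ∂((pinnedChain ω₂ lam β γ).gibbsMeasure N T)) *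
        (∫ z, g z ∂((pinnedChain ω₂ lam β γ).gibbsMeasure N T)))) (Ioi 0) := by
  have hI := pinnedChain_integrableOn_corr_nice hω hl hβ hγ hN hT hϑ0 h2ϑ hf hg hCf hCg hfb hgb
  have hexpm : Continuous fun t : ℝ => Real.exp (-(s * t)) :=
    Real.continuous_exp.comp (continuous_const.mul continuous_id).neg
  refine Integrable.mono' hI.norm (hexpm.aestronglyMeasurable.mul hI.aestronglyMeasurable) ?_
  refine (ae_restrict_iff' measurableSet_Ioi).2 (Eventually.of_forall fun t ht => ?_)
  rw [norm_mul, Real.norm_eq_abs, abs_of_pos (Real.exp_pos _)]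
  have h1 : Real.exp (-(s * t)) ≤ 1 := Real.exp_le_one_iff.2 (by nlinarith [le_of_lt (α := ℝ) ht])
  exact (mul_le_mul_of_nonneg_right h1 (norm_nonneg _)).trans_eq (one_mul _)

end Pinned

end Summit.AtomisticToContinuum.FouriersLaw.Theorems.HonestZwanzig

end
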